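import Summits.BirchSwinnertonDyer.BirchSwinnertonDyer.Theorems.ByReductionTypeAtTwoOrdKatoHalfAtTwoIsoConjATwoOfPointFieldMu
import Literature.NumberTheory.IwasawaTheory.ClassicalMuInvariantOnePrimeProofs
import Literature.NumberTheory.NumberFields.QuadraticExtensionOddClassNumberTransfer
import Literature.NumberTheory.NumberFields.AdjoinSqrtNegOneRamificationAtTwo
import HarnessLib

/-!
# Route `ByReductionTypeAtTwo` (K4), additive (A)₂ cruxes C1″ 22615 / C3″ 22617: THE GENUS DOOR — statement (A) at `(W, 2)`
# from CUBIC-FIELD DATA of the point field `ℚ(P)` ALONE (odd class number, ONE prime above `2` of odd `e`, ONE real place),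
# through the sextic carrier `ℚ(P, √−1)`, KERNEL, with NO Lim fact (a `--supports 22615` file; seat `bsd-2adic-k4-w2` GEN 9)

HONEST FRAMING (cell `bsd-2adic`, D-0036/D-0054): THEOREMS ONLY (no definition, no named fact, no `sorry`); PROVED OUTRIGHT for every
elliptic curve over `ℚ`, CONDITIONAL only on the displayed arithmetic data of ONE number field — the point field `E = ℚ̄^{Stab P}` of
a non-zero `2`-torsion point (for irreducible `W[2]`: the cubic field `ℚ(β)`): `h(E)` odd, exactly one prime above `2` in `E` with odd
ramification index over `2`, exactly one real place. These are per-field kernel certificates (k4-w1's door rows: `2` inert or `𝔭³`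
in `ℚ(β)`, `h` odd; plus `Δ_cubic < 0`), not facts from print. Closes nothing at the `∀`-level (C1″/C3″ OPEN); BSD is not proved.

THE BRIDGE (all tree theorems, this seat's GEN 9 generics + cruxlead-19573-w2's door):
`F := E ⊔ ℚ⟮i⟯ = ℚ(P, √−1)` is a quadratic, Galois, totally complex extension of `E` generated by the algebraic integer `i`;
(1) `AdjoinSqrtNegOneRamificationAtTwo`: the prime of `E` above `2` (odd `e`) ramifies in `F`, the odd primes do not, so
`∏ e(F/E) = 2` and `F` has exactly ONE prime above `2`; (2) `QuadraticExtensionOddClassNumberTransfer`: Chevalley's formula with one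
real place and one ramified finite prime transfers `h(E)` odd to `h(F)` odd (the non-norm `−1` pays for the two ramified places);
(3) Iwasawa 1956 (`iwasawa1956_…_unique_prime_holds`): `μ₂ = 0` for EVERY `ℤ₂`-extension of `F`; (4) w2's KERNEL door
`PointFieldMu.exists_fineSelmerDualData_moduleFinite_of_classicalMu_pointField_adjoin` (p718233): (A)₂ at `W`.

* **`conjA_two_of_pointField_genus`** — the door. Compared with k4-w1's `fineSelmerDual_moduleFinite_two_of_unique_prime_pointField hLim2`
  (cubic carrier, Lim 2017 Thm. 3.5 at `2` DOWNSTAIRS at a field with a real place): NO `hLim2`, one extra displayed datum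
  (`e(𝔭 | 2)` odd — automatic for inert / totally ramified `2`) and the real-place count `1` (`Δ_cubic < 0`). The totally real case
  (`Δ_cubic > 0`, three real places) needs the unit-signature form of step (2) and is NOT covered here.

References: [CoatesSujatha2005] Conj. A, Thm. 3.4; [Lim2017FineSelmer] §3 Lemma 3.2; [Greenberg2001IwasawaPastPresent] Prop. 2.1;
[Lang1990] Ch. 13 §4 Lemma 4.1; [Gras2003] IV.4; [NeukirchANT1999] I (8.2), III (2.6); tree p718233, p722124, p722472.
-/

set_option autoImplicit false
-- sibling precedent (`…OrdKatoHalfAtTwoIsoConjATwoOfPointFieldMu.lean`): the directory name repeats the summit name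
set_option linter.dupNamespace false

noncomputable section

open scoped Classical

namespace Summit.BirchSwinnertonDyer.BirchSwinnertonDyer.Theorems.AddKatoTwo

open WeierstrassCurve Field IsDedekindDomain NumberField Literature.NumberTheory.EllipticCurves
  Literature.NumberTheory.IwasawaTheory Literature.NumberTheory.NumberFields
  Summit.BirchSwinnertonDyer.BirchSwinnertonDyer.Theorems.SteinbergFibreAtTwo
  Summit.BirchSwinnertonDyer.BirchSwinnertonDyer.Theorems.AlignedTransportAtTwoTorsionPointField

/-- Iwasawa 1956 at `p = 2`, `Nat.card` form (any number field): `2 ∤ #Cl(𝓞 F)` and exactly one prime above `2` ⟹ `μ₂ = 0` for every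
`ℤ₂`-extension. [cite: Greenberg2001IwasawaPastPresent, Prop. 2.1 p. 339] [cite: Washington1997, Thm. 10.4 and Prop. 13.22] -/
private theorem classicalMuVanishes_two_of_odd_of_unique_prime {F : Type} [Field F] [NumberField F]
    (hh : ¬ 2 ∣ Nat.card (ClassGroup (𝓞 F))) (hv : ∃! v : HeightOneSpectrum (𝓞 F), ((2 : ℕ) : 𝓞 F) ∈ v.asIdeal)
    (κ : ZpExtension F 2) : ClassicalMuVanishes κ := by
  haveI : Fact (Nat.Prime 2) := ⟨Nat.prime_two⟩
  have hh' : ¬ 2 ∣ NumberField.classNumber F := by rwa [NumberField.classNumber, ← Nat.card_eq_fintype_card]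
  exact classicalMuVanishes_of_classNumberPExp_eq_zero
    iwasawa1956_classNumberPExp_eq_zero_of_not_dvd_classNumber_of_unique_prime_holds hh' hv κ

/-- `[ℚ⟮i⟯ : ℚ] = 2` for `i² = −1` (the minimal polynomial is the fourth cyclotomic polynomial). [folklore] -/
private theorem finrank_adjoin_I {i : AlgebraicClosure ℚ} (hi : i ^ 2 = -1) (hint : IsIntegral ℚ i) :
    Module.finrank ℚ ↥(IntermediateField.adjoin ℚ ({i} : Set (AlgebraicClosure ℚ))) = 2 := by
  have h4 : IsPrimitiveRoot i 4 := by
    refine IsPrimitiveRoot.mk_of_lt i (by norm_num) (by rw [show (4 : ℕ) = 2 * 2 by rfl, pow_mul, hi]; norm_num) ?_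
    intro k hk hk4
    interval_cases k
    · rw [pow_one]; intro h1; rw [h1] at hi; norm_num at hi
    · rw [hi]; norm_num
    · rw [show (3 : ℕ) = 2 + 1 by rfl, pow_succ, hi]
      intro h; have : i = -1 := by linear_combination -h
      rw [this] at hi; norm_num at hi
  rw [IntermediateField.adjoin.finrank hint, ← Polynomial.cyclotomic_eq_minpoly_rat h4 (by norm_num),
    Polynomial.natDegree_cyclotomic]
  decide

set_option maxHeartbeats 400000 in
/-- **THE GENUS DOOR.** `W/ℚ` elliptic, `P ∈ W[2] ∖ 0`, `E = ℚ̄^{Stab P}` its point field. If `E` has exactly ONE real place, ODD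
class number, and exactly ONE prime above `2`, whose ramification index over `2` is ODD, then statement (A) holds at `(W, 2)`:
for every cyclotomic `ℤ₂`-extension `κ` of `ℚ` some fine Selmer dual datum of `W` over `ℚ_∞` is finitely generated over `ℤ₂`.
KERNEL: the sextic carrier `F = E ⊔ ℚ⟮i⟯` is quadratic Galois totally complex over `E`, generated by the integer `i`; it has one
prime above `2` and `∏ e(F/E) = 2` (`existsUnique_two_mem_of_sq_eq_neg_one`, `finprod_ramificationIdxIn_eq_two_of_sq_eq_neg_one`),
odd class number (`AmbiguousClass.odd_classNumber_of_quadratic_of_nrRealPlaces_eq_one`), hence `μ₂ = 0` for every `ℤ₂`-extension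
(Iwasawa 1956), and w2's door concludes. NO Lim 2017 fact, NO Ferrero–Washington, NO ascent.
[cite: CoatesSujatha2005, Conj. A and Thm. 3.4] [cite: Greenberg2001IwasawaPastPresent, Prop. 2.1 p. 339]
[cite: Lang1990, Ch. 13 §4, Lemma 4.1 (PDF pp. 203–204)] [cite: NeukirchANT1999, Ch. I §8 Prop. (8.2)] -/
theorem conjA_two_of_pointField_genus (W : WeierstrassCurve ℚ) [W.IsElliptic] {P : geomTorsion W 2} (hP : P ≠ 0)
    (hreal : Nat.card {w : InfinitePlace ↥(IntermediateField.fixedField (MulAction.stabilizer (absoluteGaloisGroup ℚ) P)) //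
      w.IsReal} = 1)
    (hh : Odd (Nat.card (ClassGroup (𝓞 ↥(IntermediateField.fixedField (MulAction.stabilizer (absoluteGaloisGroup ℚ) P))))))
    (h2 : ∃! v : HeightOneSpectrum (𝓞 ↥(IntermediateField.fixedField (MulAction.stabilizer (absoluteGaloisGroup ℚ) P))),
      ((2 : ℕ) : 𝓞 ↥(IntermediateField.fixedField (MulAction.stabilizer (absoluteGaloisGroup ℚ) P))) ∈ v.asIdeal)
    (hodd : ∀ v : HeightOneSpectrum (𝓞 ↥(IntermediateField.fixedField (MulAction.stabilizer (absoluteGaloisGroup ℚ) P))),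
      ((2 : ℕ) : 𝓞 ↥(IntermediateField.fixedField (MulAction.stabilizer (absoluteGaloisGroup ℚ) P))) ∈ v.asIdeal →
        Odd (v.asIdeal.ramificationIdx ℤ)) :
    ∀ (κ : ZpExtension ℚ 2), κ.IsCyclotomic →
      ∃ (γ : absoluteGaloisGroup ℚ) (D : W.FineSelmerDualData κ γ),
        Module.Finite ℤ_[2] (RestrictScalars ℤ_[2] (IwasawaAlgebra 2) D.X) := by
  intro κ hκ
  haveI : Fact (Nat.Prime 2) := ⟨Nat.prime_two⟩
  obtain ⟨i, hi⟩ := IsAlgClosed.exists_pow_nat_eq (-1 : AlgebraicClosure ℚ) two_pos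
  -- the two fields
  set E : IntermediateField ℚ (AlgebraicClosure ℚ) :=
    IntermediateField.fixedField (MulAction.stabilizer (absoluteGaloisGroup ℚ) P) with hE
  set F : IntermediateField ℚ (AlgebraicClosure ℚ) := E ⊔ IntermediateField.adjoin ℚ ({i} : Set (AlgebraicClosure ℚ)) with hF
  have hint : IsIntegral ℚ i := by
    refine ⟨Polynomial.X ^ 2 + 1, Polynomial.monic_X_pow_add_C _ two_ne_zero, ?_⟩
    simp [hi]
  haveI : FiniteDimensional ℚ ↥E := finiteDimensional_fixedField_stabilizer W P
  haveI : FiniteDimensional ℚ ↥(IntermediateField.adjoin ℚ ({i} : Set (AlgebraicClosure ℚ))) :=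
    IntermediateField.adjoin.finiteDimensional hint
  haveI : FiniteDimensional ℚ ↥F := IntermediateField.finiteDimensional_sup E _
  haveI : NumberField ↥E := NumberField.mk
  haveI : NumberField ↥F := NumberField.mk
  -- `i ∉ E` (E has a real place), `i ∈ F`
  have hiF : i ∈ F := (le_sup_right : IntermediateField.adjoin ℚ ({i} : Set (AlgebraicClosure ℚ)) ≤ F)
    (IntermediateField.mem_adjoin_simple_self ℚ i)
  have hiE : i ∉ E := by
    intro hiE
    obtain ⟨⟨⟨w, hw⟩⟩, -⟩ := Nat.card_ne_zero.mp (by rw [hreal]; exact one_ne_zero)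
    exact (InfinitePlace.not_isReal_iff_isComplex.mpr (FineSelmerUpstairs.isComplex_of_mem_sq_eq_neg_one i hi E hiE w)) hw
  -- degrees: `[F : ℚ] = 2 [E : ℚ]`
  have hEF : E ≤ F := le_sup_left
  have hlt : Module.finrank ℚ ↥E < Module.finrank ℚ ↥F := by
    refine lt_of_le_of_ne (IntermediateField.finrank_le_of_le_right hEF) fun heq => hiE ?_
    rw [IntermediateField.eq_of_le_of_finrank_eq hEF heq]; exact hiF
  have hle : Module.finrank ℚ ↥F ≤ Module.finrank ℚ ↥E * 2 := by
    have h := IntermediateField.finrank_sup_le E (IntermediateField.adjoin ℚ ({i} : Set (AlgebraicClosure ℚ)))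
    rwa [finrank_adjoin_I hi hint] at h
  -- the relative structure `E → F`
  letI : Algebra ↥E ↥F := (IntermediateField.inclusion hEF).toRingHom.toAlgebra
  have halg : ∀ e : ↥E, algebraMap ↥E ↥F e = IntermediateField.inclusion hEF e := fun _ => rfl
  haveI : IsScalarTower ℚ ↥E ↥F := IsScalarTower.of_algebraMap_eq fun q =>
    ((IntermediateField.inclusion hEF).commutes q).symm
  haveI : Module.Finite ↥E ↥F := Module.Finite.of_restrictScalars_finite ℚ ↥E ↥F
  have hdeg : Module.finrank ↥E ↥F = 2 := by
    have htower := Module.finrank_mul_finrank ℚ ↥E ↥F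
    have hpos : 0 < Module.finrank ℚ ↥E := Module.finrank_pos
    have h1 : Module.finrank ↥E ↥F ≤ 2 := by
      by_contra h; push Not at h
      have : Module.finrank ℚ ↥E * 3 ≤ Module.finrank ℚ ↥E * Module.finrank ↥E ↥F := Nat.mul_le_mul_left _ h
      omega
    have h2' : Module.finrank ↥E ↥F ≠ 1 := by
      intro h1'; rw [h1', mul_one] at htower; omega
    have h0 : Module.finrank ↥E ↥F ≠ 0 := by
      intro h0'; rw [h0', mul_zero] at htower; omega
    omega
  haveI : Algebra.IsQuadraticExtension ↥E ↥F := ⟨hdeg⟩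
  haveI : IsGalois ↥E ↥F := inferInstance
  haveI : IsTotallyComplex ↥F := ⟨FineSelmerUpstairs.isComplex_of_mem_sq_eq_neg_one i hi F hiF⟩
  -- the integer `x = i ∈ 𝓞 F`, `x² = −1`, generating `F` over `E`
  set y : ↥F := ⟨i, hiF⟩ with hy
  have hy2 : y ^ 2 = -1 := Subtype.ext (by simp [hy, hi])
  have hyint : IsIntegral ℤ y := ⟨Polynomial.X ^ 2 + 1, Polynomial.monic_X_pow_add_C _ two_ne_zero, by simp [hy2]⟩
  set x : 𝓞 ↥F := ⟨y, hyint⟩ with hx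
  have hx2 : x ^ 2 = -1 := by ext; simp [hx, hy2]
  have hxy : (x : ↥F) = y := rfl
  have hgen : Algebra.adjoin ↥E {(x : ↥F)} = ⊤ := by
    rw [hxy]
    have hyE : IsIntegral ↥E y := IsIntegral.tower_top (hyint.tower_top (A := ℚ))
    have hnot : y ∉ (algebraMap ↥E ↥F).range := by
      rintro ⟨e, he⟩
      apply hiE
      have : ((IntermediateField.inclusion hEF e : ↥F) : AlgebraicClosure ℚ) = i := by
        rw [← halg, he]
      rw [IntermediateField.coe_inclusion] at this
      rw [← this]; exact e.2
    have h2le : 2 ≤ (minpoly ↥E y).natDegree := (minpoly.two_le_natDegree_iff hyE).mpr hnot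
    have htop : IntermediateField.adjoin ↥E ({y} : Set ↥F) = ⊤ := by
      refine IntermediateField.eq_of_le_of_finrank_eq le_top ?_
      rw [IntermediateField.adjoin.finrank hyE, IntermediateField.finrank_top', hdeg]
      refine le_antisymm ?_ h2le
      rw [← hdeg, ← IntermediateField.finrank_top', ← IntermediateField.adjoin.finrank hyE]
      exact IntermediateField.finrank_le_of_le_right le_top
    rw [← IntermediateField.adjoin_simple_toSubalgebra_of_isAlgebraic hyE.isAlgebraic, htop, IntermediateField.top_toSubalgebra]
  -- a generator of `Gal(F/E)` (cyclic of order `2`)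
  have hcard : Nat.card (↥F ≃ₐ[↥E] ↥F) = 2 := by rw [IsGalois.card_aut_eq_finrank, hdeg]
  haveI : IsCyclic (↥F ≃ₐ[↥E] ↥F) := isCyclic_of_prime_card (p := 2) hcard
  obtain ⟨σ, hσ⟩ := IsCyclic.exists_generator (α := ↥F ≃ₐ[↥E] ↥F)
  -- (1) ramification above `2`; (2) class number parity; (3) Iwasawa 1956; (4) w2's door
  have hv : ∃! w : HeightOneSpectrum (𝓞 ↥F), ((2 : ℕ) : 𝓞 ↥F) ∈ w.asIdeal :=
    existsUnique_two_mem_of_sq_eq_neg_one hdeg hx2 h2 hodd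
  have hprod : (∏ᶠ v : HeightOneSpectrum (𝓞 ↥E), v.asIdeal.ramificationIdxIn (𝓞 ↥F)) = 2 :=
    finprod_ramificationIdxIn_eq_two_of_sq_eq_neg_one hdeg hx2 hgen h2 hodd
  have hrealE : NumberField.InfinitePlace.nrRealPlaces ↥E = 1 := by
    rw [NumberField.InfinitePlace.nrRealPlaces, ← Nat.card_eq_fintype_card]; exact hreal
  have hhE : Odd (classNumber ↥E) := by rwa [NumberField.classNumber, ← Nat.card_eq_fintype_card]
  have hhF : Odd (classNumber ↥F) :=
    AmbiguousClass.odd_classNumber_of_quadratic_of_nrRealPlaces_eq_one hσ hdeg hrealE hprod hhE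
  have hhF' : ¬ 2 ∣ Nat.card (ClassGroup (𝓞 ↥F)) := by
    rw [Nat.card_eq_fintype_card, ← NumberField.classNumber]
    exact hhF.not_two_dvd_nat
  exact PointFieldMu.exists_fineSelmerDualData_moduleFinite_of_classicalMu_pointField_adjoin W hP hi
    (fun κF _ => classicalMuVanishes_two_of_odd_of_unique_prime hhF' hv κF) κ hκ

end Summit.BirchSwinnertonDyer.BirchSwinnertonDyer.Theorems.AddKatoTwo

end
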